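import Summits.HubbardSuperconductivity.HubbardSuperconductivity.Theses.PolyaSchurPairBoson
import Summits.AtomisticToContinuum.BoseEinsteinCondensation.Theorems.BECStronglyRayleighPairKernelSumRule

/-!
# Route `PolyaSchurPairBoson`, support `PairKernelSumRule` (stmt-HubbardSuperconductivity-10293)

The double-counting identity behind "condensate = pair-insertion coherence": for `φ` supported on
`N`-subsets of a finite type (`N ≥ 2`) and `r^T_x = Σ_{y ∉ T, y ≠ x} φ(T ∪ {x, y})` (`|T| = N − 2`),
`Σ_{|T| = N−2} Σ_x (r^T_x)² = (N − 1) Σ_{x,y} γ(x, y)` with `γ` the one-body matrix of `φ`. The item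
is stated VERBATIM as the BEC route's support `stmt-AtomisticToContinuum-9676`
(`BECStronglyRayleigh.PairKernelSumRule`), proved in the tree as
`Summit.AtomisticToContinuum.BoseEinsteinCondensation.Theorems.PairKernelSumRule_proof`
(`Theorems/BECStronglyRayleighPairKernelSumRule.lean`); the two propositions are syntactically equal,
so the proof transfers by `Iff.rfl`-level definitional unfolding.

Sources: B. Tóth, J. Stat. Phys. 65 (1991) 373; O. Penrose, L. Onsager, Phys. Rev. 104 (1956) 576.
No definition is introduced.
-/

set_option linter.dupNamespace false

namespace Summit.HubbardSuperconductivity.HubbardSuperconductivity.Theorems.PolyaSchurPairBoson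

open Summit.HubbardSuperconductivity.HubbardSuperconductivity.Theses.PolyaSchurPairBoson

/-- The Hubbard-route item and the BEC-route item are one proposition. [folklore] -/
theorem pairKernelSumRule_iff_bec :
    PairKernelSumRule ↔
      Summit.AtomisticToContinuum.BoseEinsteinCondensation.Theses.BECStronglyRayleigh.PairKernelSumRule :=
  Iff.rfl

/-- **`PairKernelSumRule` holds** (route `PolyaSchurPairBoson`, item `stmt-HubbardSuperconductivity-10293`):
transferred from the landed BEC-route proof `PairKernelSumRule_proof` (pure double counting,
`(T, x) ↦ T ∪ {x}` is `(N−1)`-to-`1`). Tóth, J. Stat. Phys. 65 (1991) 373. [folklore] -/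
theorem pairKernelSumRule_proof : PairKernelSumRule :=
  pairKernelSumRule_iff_bec.mpr
    Summit.AtomisticToContinuum.BoseEinsteinCondensation.Theorems.PairKernelSumRule_proof

end Summit.HubbardSuperconductivity.HubbardSuperconductivity.Theorems.PolyaSchurPairBoson
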